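import Mathlib
import Literature.Computability.AlgebraicComplexity.DivisionSLP

/-!
# Crux `CondensationSound` (stmt-MatrixMultiplication-15939), line `Sketch`: `stub_simulation`

Route `MatrixMultiplication/CondensationDistance`, crux
`Summit.MatrixMultiplication.MatrixMultiplication.Theses.CondensationDistance.CondensationSound`, line `Sketch`
(skeleton `Cruxes/CondensationSound/Lines/Sketch.lean`), registered stub `stub_simulation` — the BOOKKEEPING half
of the soundness bridge, abstract in the field `K`, the input set `A` and the coordinate system `P` on column sets:

if (a) every ball value `P J` (`|J| = n`, at most one element `≥ n`) is an input or a constant up to a nonzero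
scalar, (b) `P J ≠ 0` whenever `|J| = n`, and (c) every octahedron `{J, J−p+u, J−p+v, J−q+u, J−q+v, J−p−q+u+v}`
satisfies an exchange relation `P J · P J₅ = ε₁ · P J₁ P J₄ + ε₂ · P J₂ P J₃`, then along every VALID derivation
`f : Fin l → Finset (Fin (n + m'))` (the route's validity predicate verbatim) the set `{P (f i)}` is
`Derivable ℂ (5 * l)` from `A` in the division-SLP model of `Literature/…/DivisionSLP.lean` (BCS 1997,
Def. (4.4)/(4.7)).

* `octahedron_five_steps`: one octahedron is `mul, mul, lin, inv, mul` = five `DivStep`s even when the five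
  premises are available only up to nonzero scalars — the scalars of the linear-combination step are free in the
  model and absorb the twists, and the output is the EXACT coordinate (idea card `raw-minors-unit-absorption`).
* `stub_simulation`: induction on a prefix length `k ≤ l` with the invariant `|f i| = n` for the listed sets
  (`J₁ = insert u ((f i).erase p)` has `n` elements by the ball clause or by induction, and `p ∈ f i`, `u ∉ f i`);
  `Derivable.trans` / `.union` chain the octahedra with additive cost `5k + 5`.
-/

set_option linter.dupNamespace false

namespace Summit.MatrixMultiplication.MatrixMultiplication.Theorems.CondensationSound

open Literature.Computability.AlgebraicComplexity (Derivable DivStep DivSeq)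

/-- **One octahedron = five Ω-steps, with twisted premises.**  In a field `K ⊇ ℂ`, if `a', b', c', d', e'` are
available (in `A` or constants), the true coordinates are scalar multiples `a = α • a'`, …, `e = η • e'` with
`e ≠ 0`, and `t · e = c₀ · (a b) + d₀ · (c d)`, then `t` itself is derivable from `A` in `5` steps:
`x₁ = a' b'`, `x₂ = c' d'`, `x₃ = (c₀αβ/η) x₁ + (d₀γδ/η) x₂`, `x₄ = e'⁻¹`, `x₅ = x₃ x₄ = t`. [folklore] -/
theorem octahedron_five_steps {K : Type} [Field K] [Algebra ℂ K] {A : Set K}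
    {t a b c d e a' b' c' d' e' : K} {α β γ δ η c₀ d₀ : ℂ}
    (ha : a' ∈ A ∪ Set.range (algebraMap ℂ K)) (hb : b' ∈ A ∪ Set.range (algebraMap ℂ K))
    (hc : c' ∈ A ∪ Set.range (algebraMap ℂ K)) (hd : d' ∈ A ∪ Set.range (algebraMap ℂ K))
    (he : e' ∈ A ∪ Set.range (algebraMap ℂ K))
    (hα : a = α • a') (hβ : b = β • b') (hγ : c = γ • c') (hδ : d = δ • d') (hη : e = η • e')
    (he0 : e ≠ 0) (rel : t * e = c₀ • (a * b) + d₀ • (c * d)) :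
    Derivable ℂ 5 A {t} := by
  let κ₁ : ℂ := c₀ * α * β * η⁻¹
  let κ₂ : ℂ := d₀ * γ * δ * η⁻¹
  -- the twists of the divisor are nonzero
  have hη0 : η ≠ 0 := by
    rintro rfl
    exact he0 (by rw [hη, zero_smul])
  have he'0 : e' ≠ 0 := by
    rintro rfl
    exact he0 (by rw [hη, smul_zero])
  -- the exact value of `t` in terms of the available premises
  have ht : t = (κ₁ • (a' * b') + κ₂ • (c' * d')) * e'⁻¹ := by
    have h1 : t = t * e * e⁻¹ := (mul_inv_cancel_right₀ he0 t).symm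
    have hηK : algebraMap ℂ K η ≠ 0 := by
      rw [Ne, map_eq_zero_iff _ (algebraMap ℂ K).injective]
      exact hη0
    rw [h1, rel, hα, hβ, hγ, hδ, hη]
    simp only [κ₁, κ₂, Algebra.smul_def, map_mul, map_inv₀, mul_inv]
    field_simp
  -- steps 1, 2: the two products
  have s12 : Derivable ℂ (1 + 1) A ({a' * b'} ∪ {c' * d'}) :=
    (Derivable.mul ha hb).union (Derivable.mul hc hd)
  -- step 3: the linear combination
  have m₁ : a' * b' ∈ (A ∪ ({a' * b'} ∪ {c' * d'})) ∪ Set.range (algebraMap ℂ K) :=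
    Or.inl (Or.inr (Or.inl rfl))
  have m₂ : c' * d' ∈ (A ∪ ({a' * b'} ∪ {c' * d'})) ∪ Set.range (algebraMap ℂ K) :=
    Or.inl (Or.inr (Or.inr rfl))
  have s3 : Derivable ℂ 1 (A ∪ ({a' * b'} ∪ {c' * d'})) {κ₁ • (a' * b') + κ₂ • (c' * d')} :=
    Derivable.lin m₁ m₂ κ₁ κ₂
  have s123 : Derivable ℂ (1 + 1 + 1) A {κ₁ • (a' * b') + κ₂ • (c' * d')} := s12.trans s3
  -- step 4: the inverse of the divisor
  have s4 : Derivable ℂ 1 A {e'⁻¹} := Derivable.inv he he'0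
  have s1234 : Derivable ℂ (1 + 1 + 1 + 1) A ({κ₁ • (a' * b') + κ₂ • (c' * d')} ∪ {e'⁻¹}) :=
    s123.union s4
  -- step 5: the final product
  have m₃ : κ₁ • (a' * b') + κ₂ • (c' * d') ∈
      (A ∪ ({κ₁ • (a' * b') + κ₂ • (c' * d')} ∪ {e'⁻¹})) ∪ Set.range (algebraMap ℂ K) :=
    Or.inl (Or.inr (Or.inl rfl))
  have m₄ : e'⁻¹ ∈ (A ∪ ({κ₁ • (a' * b') + κ₂ • (c' * d')} ∪ {e'⁻¹})) ∪ Set.range (algebraMap ℂ K) :=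
    Or.inl (Or.inr (Or.inr rfl))
  have s5 : Derivable ℂ 1 (A ∪ ({κ₁ • (a' * b') + κ₂ • (c' * d')} ∪ {e'⁻¹}))
      {(κ₁ • (a' * b') + κ₂ • (c' * d')) * e'⁻¹} :=
    Derivable.mul m₃ m₄
  have s12345 := s1234.trans s5
  rw [← ht] at s12345
  exact s12345.mono (by norm_num) subset_rfl subset_rfl

/-- **STUB `stub_simulation` — valid derivations are division-SLPs, five Ω-steps per octahedron** (registered
stub of crux stmt-MatrixMultiplication-15939, line `Sketch`; abstract in the field `K`, the input set `A` and the
coordinate system `P`).  If (a) every ball value `P J` (`|J| = n`, at most one element `≥ n`) is an input or a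
constant up to a nonzero scalar, (b) `P J ≠ 0` for `|J| = n`, and (c) every octahedron satisfies an exchange
relation, then along every valid derivation `f : Fin l → _` the set `{P (f i)}` is `Derivable ℂ (5 * l)` from
`A`.  Proof: induction on a prefix length `k ≤ l` with the invariant `|f i| = n`; each step is
`octahedron_five_steps` over the already derived set, chained by `Derivable.trans`. [folklore] -/
theorem stub_simulation :
    ∀ (K : Type) [Field K] [Algebra ℂ K] (A : Set K) (n m' : ℕ) (P : Finset (Fin (n + m')) → K),
      (∀ J : Finset (Fin (n + m')), J.card = n →
        (J.filter fun x : Fin (n + m') => n ≤ x.val).card ≤ 1 →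
          ∃ ε : ℂ, ε ≠ 0 ∧ ε • P J ∈ A ∪ Set.range (algebraMap ℂ K)) →
      (∀ J : Finset (Fin (n + m')), J.card = n → P J ≠ 0) →
      (∀ (J : Finset (Fin (n + m'))) (p q u v : Fin (n + m')),
        J.card = n → p ∈ J → q ∈ J → p ≠ q → u ∉ J → v ∉ J → u ≠ v →
          ∃ ε₁ ε₂ : ℂ,
            P J * P (insert u (insert v ((J.erase p).erase q))) =
              ε₁ • (P (insert u (J.erase p)) * P (insert v (J.erase q))) +
                ε₂ • (P (insert v (J.erase p)) * P (insert u (J.erase q)))) →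
      ∀ (l : ℕ) (f : Fin l → Finset (Fin (n + m'))),
        (∀ i : Fin l, ∃ p ∈ f i, ∃ q ∈ f i, p ≠ q ∧ ∃ u ∉ f i, ∃ v ∉ f i, u ≠ v ∧
          ∀ J ∈ [insert u ((f i).erase p), insert v ((f i).erase p), insert u ((f i).erase q),
            insert v ((f i).erase q), insert u (insert v (((f i).erase p).erase q))],
            (J.card = n ∧ (J.filter fun x : Fin (n + m') => n ≤ x.val).card ≤ 1) ∨
              ∃ j : Fin l, j < i ∧ f j = J) →
        Derivable ℂ (5 * l) A (Set.range fun i : Fin l => P (f i)) := by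
  intro K _ _ A n m' P hball hnz hex l f hvalid
  classical
  -- `D k` = the values of the first `k` listed sets
  let D : ℕ → Set K := fun k => {x | ∃ i : Fin l, i.val < k ∧ x = P (f i)}
  have main : ∀ k : ℕ, k ≤ l →
      (∀ i : Fin l, i.val < k → (f i).card = n) ∧ Derivable ℂ (5 * k) A (D k) := by
    intro k
    induction k with
    | zero =>
      intro _
      refine ⟨fun i hi => absurd hi (Nat.not_lt_zero _), Derivable.of_subset ?_ _⟩
      rintro x ⟨i, hi, -⟩
      exact absurd hi (Nat.not_lt_zero _)
    | succ k ih =>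
      intro hk
      obtain ⟨hcard, hD⟩ := ih (Nat.le_of_succ_le hk)
      let i : Fin l := ⟨k, hk⟩
      obtain ⟨p, hp, q, hq, hpq, u, hu, v, hv, huv, hmates⟩ := hvalid i
      -- every mate has `n` elements and is available, up to a scalar, over `A ∪ D k`
      have avail : ∀ J : Finset (Fin (n + m')),
          ((J.card = n ∧ (J.filter fun x : Fin (n + m') => n ≤ x.val).card ≤ 1) ∨
            ∃ j : Fin l, j < i ∧ f j = J) →
          J.card = n ∧ ∃ (a : ℂ) (y : K), y ∈ (A ∪ D k) ∪ Set.range (algebraMap ℂ K) ∧ P J = a • y := by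
        rintro J (⟨hJn, hJb⟩ | ⟨j, hj, rfl⟩)
        · obtain ⟨ε, hε, hmem⟩ := hball J hJn hJb
          refine ⟨hJn, ε⁻¹, ε • P J, ?_, (inv_smul_smul₀ hε _).symm⟩
          rcases hmem with h | h
          · exact Or.inl (Or.inl h)
          · exact Or.inr h
        · have hjk : j.val < k := hj
          exact ⟨hcard j hjk, 1, P (f j), Or.inl (Or.inr ⟨j, hjk, rfl⟩), (one_smul _ _).symm⟩
      obtain ⟨hc₁, α₁, y₁, hy₁, hP₁⟩ := avail (insert u ((f i).erase p)) (hmates _ (by simp))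
      obtain ⟨-, α₂, y₂, hy₂, hP₂⟩ := avail (insert v ((f i).erase p)) (hmates _ (by simp))
      obtain ⟨-, α₃, y₃, hy₃, hP₃⟩ := avail (insert u ((f i).erase q)) (hmates _ (by simp))
      obtain ⟨-, α₄, y₄, hy₄, hP₄⟩ := avail (insert v ((f i).erase q)) (hmates _ (by simp))
      obtain ⟨hc₅, α₅, y₅, hy₅, hP₅⟩ :=
        avail (insert u (insert v (((f i).erase p).erase q))) (hmates _ (by simp))
      -- the listed set itself has `n` elements
      have hcardi : (f i).card = n := by
        have h1 : (insert u ((f i).erase p)).card = ((f i).erase p).card + 1 :=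
          Finset.card_insert_of_notMem fun h => hu (Finset.mem_of_mem_erase h)
        have h2 := Finset.card_erase_of_mem hp
        have h3 : 0 < (f i).card := Finset.card_pos.mpr ⟨p, hp⟩
        omega
      -- the exchange relation and the five steps over `A ∪ D k`
      obtain ⟨ε₁, ε₂, hrel⟩ := hex (f i) p q u v hcardi hp hq hpq hu hv huv
      have hstep : Derivable ℂ 5 (A ∪ D k) {P (f i)} :=
        octahedron_five_steps hy₁ hy₄ hy₂ hy₃ hy₅ hP₁ hP₄ hP₂ hP₃ hP₅ (hnz _ hc₅) hrel
      refine ⟨fun j hj => ?_, ?_⟩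
      · rcases Nat.lt_succ_iff_lt_or_eq.1 hj with hj | hj
        · exact hcard j hj
        · have : j = i := Fin.ext hj
          rw [this]
          exact hcardi
      · have hstep' : Derivable ℂ (0 + 5) (A ∪ D k) (D k ∪ {P (f i)}) :=
          (Derivable.of_subset (fun x hx => Or.inl (Or.inr hx)) 0).union hstep
        refine (hD.trans hstep').mono (by omega) subset_rfl ?_
        rintro x ⟨j, hj, rfl⟩
        rcases Nat.lt_succ_iff_lt_or_eq.1 hj with hj | hj
        · exact Or.inl ⟨j, hj, rfl⟩
        · have : j = i := Fin.ext hj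
          subst this
          exact Or.inr rfl
  refine (main l le_rfl).2.mono le_rfl subset_rfl ?_
  rintro x ⟨i, rfl⟩
  exact ⟨i, i.isLt, rfl⟩

end Summit.MatrixMultiplication.MatrixMultiplication.Theorems.CondensationSound
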